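import Mathlib
import Summits.SmoothPoincare4.SmoothPoincare4.Theorems.CylinderEntropyCylinderRungTwoKCertSoundBoxZ
import HarnessLib

/-!
# Kernel certificate checker for `stub_certMid`, IX: soundness of the leaf test and of the bisection

Infrastructure file for the kernel-clean discharge of the registered stub `stub_certMid` of crux stmt-SmoothPoincare4-7631
(`Summit.SmoothPoincare4.SmoothPoincare4.Theses.CylinderEntropy.CylinderRungTwo`, line `killing-flux`).  A box whose data
satisfy the invariants (`BoxOK`) and which passes `leafOKF` satisfies `E_T ≤ R` at every point and every `T ∈ [T₁, T₂]`:
the zeroth-order test directly; the corner test by reduction of `T` to the envelope range, interval enclosures of the two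
partial derivatives of `R - E_T`, and the mean value theorem from the nearest corner.  Then `runF` (script replay) is sound
by induction on the fuel, and the sub-boxes of the root partition have valid data.
No named facts.
-/

-- the registered namespace `Summit.SmoothPoincare4.SmoothPoincare4.…` repeats a component
set_option linter.dupNamespace false

noncomputable section

namespace Summit.SmoothPoincare4.SmoothPoincare4.Cruxes.CylinderRungTwo.KillingFlux

namespace KCert

open Set
open Literature.Analysis.ValidatedNumerics.NumericsMP
open Summit.SmoothPoincare4.SmoothPoincare4.Theorems.CylinderEntropySliceIsolation
open Summit.SmoothPoincare4.SmoothPoincare4.Theorems.CylinderEntropySliceIsolation.Cert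

variable (C : KCell)

/-! ### Derivatives of the certificate -/

/-- The `u`-derivative of the certificate (list form, same product order as the checker). [folklore] -/
def KCell.dRu (C : KCell) (u θ : ℝ) : ℝ :=
  (C.atoms.map fun a => a.G u * a.Zc θ * (-(u - a.σ) / (2 * a.tau)) * a.w).sum

/-- The `θ`-derivative of the certificate. [folklore] -/
def KCell.dRt (C : KCell) (u θ : ℝ) : ℝ :=
  (C.atoms.map fun a => a.G u * a.Zc θ * (a.fd θ - θ / (2 * a.tau)) * a.w).sum

/-- Derivative of a list sum of atom terms in `u`. [folklore] -/
theorem hasDerivAt_sum_u {l : List KAtom} (hA : ∀ a ∈ l, atomOK C a = true) (θ u : ℝ) :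
    HasDerivAt (fun v => (l.map fun a => (a.w : ℝ) * a.G v * a.Zc θ).sum)
      (l.map fun a => a.G u * a.Zc θ * (-(u - a.σ) / (2 * a.tau)) * a.w).sum u := by
  induction l with
  | nil => simpa using hasDerivAt_const u (0 : ℝ)
  | cons a l ih =>
    simp only [List.map_cons, List.sum_cons]
    refine HasDerivAt.add ?_ (ih fun b hb => hA b (List.mem_cons_of_mem _ hb))
    have h := ((hasDerivAt_G C (hA a (List.mem_cons_self ..)) u).const_mul (a.w : ℝ)).mul_const (a.Zc θ)
    refine h.congr_deriv ?_
    ring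

/-- Derivative of a list sum of atom terms in `θ`. [folklore] -/
theorem hasDerivAt_sum_t {l : List KAtom} (hA : ∀ a ∈ l, atomOK C a = true) (u θ : ℝ) :
    HasDerivAt (fun x => (l.map fun a => (a.w : ℝ) * a.G u * a.Zc x).sum)
      (l.map fun a => a.G u * a.Zc θ * (a.fd θ - θ / (2 * a.tau)) * a.w).sum θ := by
  induction l with
  | nil => simpa using hasDerivAt_const θ (0 : ℝ)
  | cons a l ih =>
    simp only [List.map_cons, List.sum_cons]
    refine HasDerivAt.add ?_ (ih fun b hb => hA b (List.mem_cons_of_mem _ hb))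
    have h := (hasDerivAt_Zc C (hA a (List.mem_cons_self ..)) θ).const_mul ((a.w : ℝ) * a.G u)
    refine h.congr_deriv ?_
    ring

/-- **`∂_u R = dRu`.** [folklore] -/
theorem hasDerivAt_R_u (hat : atomsOK C C.atoms = true) (θ u : ℝ) :
    HasDerivAt (fun v => C.R v θ) (C.dRu u θ) u := by
  unfold KCell.R KCell.dRu
  exact (hasDerivAt_sum_u C (atomsOK_forall C hat) θ u).const_add _

/-- **`∂_θ R = dRt`.** [folklore] -/
theorem hasDerivAt_R_t (hat : atomsOK C C.atoms = true) (u θ : ℝ) :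
    HasDerivAt (fun x => C.R u x) (C.dRt u θ) θ := by
  unfold KCell.R KCell.dRt
  exact (hasDerivAt_sum_t C (atomsOK_forall C hat) u θ).const_add _

/-! ### Boxes -/

/-- The certified corner bound: `S · E_T(u, θ̂) ≤ e` for all `T ∈ [T₁, T₂]`. [folklore] -/
def CornerOK (U : UD) (T : TD) (e : ℤ) : Prop :=
  ∀ T' : ℝ, ((C.T1 : ℚ) : ℝ) ≤ T' → T' ≤ ((C.T2 : ℚ) : ℝ) → Ek T' U.u T.th * S64 ≤ ((e : ℤ) : ℝ)

/-- **Invariant of a box**: valid end-point data and valid corner bounds. [folklore] -/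
def BoxOK (tabs : List (List TabE)) (B : BoxD) : Prop :=
  UDok C B.U1 ∧ UDok C B.U2 ∧ TDok C B.T1 ∧ TDok C B.T2 ∧
    CornerOK C B.U1 B.T1 B.e11 ∧ CornerOK C B.U1 B.T2 B.e12 ∧ CornerOK C B.U2 B.T1 B.e21 ∧ CornerOK C B.U2 B.T2 B.e22 ∧
    tabs = tabs

/-- A point `(u, θ)` of the box (real angle coordinates: `t₁ ≤ θ ≤ t₂`, `θ ≤ π`). [folklore] -/
def InBox (B : BoxD) (u θ : ℝ) : Prop :=
  (B.U1.u : ℝ) ≤ u ∧ u ≤ (B.U2.u : ℝ) ∧ (B.T1.t : ℝ) ≤ θ ∧ θ ≤ (B.T2.t : ℝ) ∧ θ ≤ Real.pi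

/-- The claim certified on a box. [folklore] -/
def BoxClaim (B : BoxD) : Prop :=
  ∀ u θ, InBox B u θ → ∀ T : ℝ, ((C.T1 : ℚ) : ℝ) ≤ T → T ≤ ((C.T2 : ℚ) : ℝ) → Ek T u θ ≤ C.R u θ

/-! ### `Q` on a box -/

/-- `Qlo ≤ Q`. [folklore] -/
theorem Qlo_le_Qk {xlo xhi chi : ℚ} {u θ : ℝ} (hxlo : ((xlo : ℚ) : ℝ) ≤ Real.exp u) (hxhi : Real.exp u ≤ ((xhi : ℚ) : ℝ))
    (hc : Real.cos θ ≤ ((chi : ℚ) : ℝ)) :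
    ((((clampQ chi xlo xhi - chi) ^ 2 + (1 - chi ^ 2) : ℚ)) : ℝ) ≤ Qk u θ := by
  have h := Q_lower u (Real.cos θ) (chi : ℝ) (xlo : ℝ) (xhi : ℝ) hxlo hxhi hc
  unfold Qk clampQ
  push_cast
  exact h

/-- `Q ≤ Qhi`. [folklore] -/
theorem Qk_le_Qhi {xa xb cl : ℚ} {u θ : ℝ} (hx1 : ((xa : ℚ) : ℝ) ≤ Real.exp u) (hx2 : Real.exp u ≤ ((xb : ℚ) : ℝ))
    (hc : ((cl : ℚ) : ℝ) ≤ Real.cos θ) :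
    Qk u θ ≤ (((max (xa ^ 2 + 1 - 2 * xa * cl) (xb ^ 2 + 1 - 2 * xb * cl) : ℚ)) : ℝ) := by
  have hx0 : 0 < Real.exp u := Real.exp_pos u
  have h1 : Qk u θ ≤ Real.exp u ^ 2 + 1 - 2 * Real.exp u * (cl : ℝ) := by
    unfold Qk
    have : Real.exp (2 * u) = Real.exp u ^ 2 := by rw [sq, ← Real.exp_add]; ring_nf
    rw [this]; nlinarith [mul_le_mul_of_nonneg_left hc hx0.le]
  refine h1.trans ?_
  have h2 := quad_le_max (cl := ((cl : ℚ) : ℝ)) hx1 hx2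
  push_cast; exact h2

/-! ### The kernel-side quantities of a box -/

/-- The real data of a point of a valid box: `toQ xa ≤ e^u ≤ toQ xb`, `0 ≤ toQ xa`, `toQ cl ≤ cos θ ≤ toQ ch`,
`-1 ≤ toQ ch ≤ 1`, `0 ≤ θ`, `θ̂₁ ≤ θ ≤ θ̂₂`, `θ̂₁ = t₁`. [folklore] -/
theorem point_data {tabs : List (List TabE)} {B : BoxD} (hB : BoxOK C tabs B) {u θ : ℝ} (hp : InBox B u θ) :
    ((toQ B.U1.x.lo : ℚ) : ℝ) ≤ Real.exp u ∧ Real.exp u ≤ ((toQ B.U2.x.hi : ℚ) : ℝ) ∧ 0 ≤ toQ B.U1.x.lo ∧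
    ((toQ B.T2.cs.lo : ℚ) : ℝ) ≤ Real.cos θ ∧ Real.cos θ ≤ ((toQ B.T1.cs.hi : ℚ) : ℝ) ∧
    -1 ≤ toQ B.T1.cs.hi ∧ toQ B.T1.cs.hi ≤ 1 ∧ 0 ≤ θ ∧ B.T1.th ≤ θ ∧ θ ≤ B.T2.th ∧ B.T1.th = (B.T1.t : ℝ) := by
  obtain ⟨⟨⟨hx1, hx10⟩, _, _⟩, ⟨⟨hx2, _⟩, _, _⟩, ⟨ht1, hcs1, hlo1, hhi1, _⟩, ⟨ht2, hcs2, _, _, _⟩, _⟩ := hB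
  obtain ⟨hu1, hu2, hθ1, hθ2, hθπ⟩ := hp
  have hS := S64_cast_pos.2
  have hθ0 : 0 ≤ θ := le_trans (by exact_mod_cast ht1) hθ1
  have hth1 : B.T1.th = (B.T1.t : ℝ) := min_eq_left (hθ1.trans hθπ)
  have hθ1' : B.T1.th ≤ θ := hth1 ▸ hθ1
  have hθ2' : θ ≤ B.T2.th := le_min hθ2 hθπ
  have hT2 := TD.th_mem ht2
  have hT1 := TD.th_mem ht1
  refine ⟨?_, ?_, ?_, ?_, ?_, ?_, ?_, hθ0, hθ1', hθ2', hth1⟩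
  · exact toQ_le_of (hx1.1.trans (mul_le_mul_of_nonneg_right (Real.exp_le_exp.2 hu1) hS.le))
  · exact le_toQ_of (le_trans (mul_le_mul_of_nonneg_right (Real.exp_le_exp.2 hu2) hS.le) hx2.2)
  · unfold toQ; exact div_nonneg (by exact_mod_cast hx10) (by norm_num [S64])
  · refine toQ_le_of (hcs2.1.trans (mul_le_mul_of_nonneg_right ?_ hS.le))
    exact Real.cos_le_cos_of_nonneg_of_le_pi hθ0 hT2.2 hθ2'
  · refine le_toQ_of (le_trans (mul_le_mul_of_nonneg_right ?_ hS.le) hcs1.2)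
    exact Real.cos_le_cos_of_nonneg_of_le_pi hT1.1 hθπ hθ1'
  · unfold toQ
    rw [le_div_iff₀ (by norm_num [S64])]
    have h := hcs1.1.trans hcs1.2
    have hl : (-(S64 : ℤ) : ℝ) ≤ (B.T1.cs.hi : ℝ) := le_trans (by exact_mod_cast hlo1) h
    have : (-(S64 : ℤ) : ℚ) ≤ (B.T1.cs.hi : ℚ) := by exact_mod_cast (show -(S64 : ℤ) ≤ B.T1.cs.hi by exact_mod_cast hl)
    push_cast at this; linarith
  · unfold toQ
    rw [div_le_iff₀ (by norm_num [S64])]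
    have : ((B.T1.cs.hi : ℤ) : ℚ) ≤ ((S64 : ℤ) : ℚ) := by exact_mod_cast hhi1
    push_cast at this; linarith

/-- **The kernel quantities of a valid box.** With `(EhiB, EloB, Ta, Tb) := leafE C B` and a point of the box:
`E_T ≤ EhiB` for `T ∈ [T₁, T₂]`; `EloB ≤ E_T` for `T ∈ [Ta, Tb]`; and every `T ∈ [T₁, T₂]` reduces to some
`T' ∈ [Ta, Tb] ∩ [T₁, T₂]` with `E_T ≤ E_{T'}` (pointwise on the box). [folklore] -/
theorem leafE_spec (hT1 : 0 < C.T1) (hT12 : C.T1 ≤ C.T2) {tabs : List (List TabE)} {B : BoxD} (hB : BoxOK C tabs B)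
    {u θ : ℝ} (hp : InBox B u θ) :
    (∀ T : ℝ, ((C.T1 : ℚ) : ℝ) ≤ T → T ≤ ((C.T2 : ℚ) : ℝ) → Ek T u θ ≤ (((leafE C B).1 : ℚ) : ℝ)) ∧
    (∀ T : ℝ, (((leafE C B).2.2.1 : ℚ) : ℝ) ≤ T → T ≤ (((leafE C B).2.2.2 : ℚ) : ℝ) → (((leafE C B).2.1 : ℚ) : ℝ) ≤ Ek T u θ) ∧
    (∀ T : ℝ, ((C.T1 : ℚ) : ℝ) ≤ T → T ≤ ((C.T2 : ℚ) : ℝ) → ∃ T' : ℝ, (((leafE C B).2.2.1 : ℚ) : ℝ) ≤ T' ∧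
      T' ≤ (((leafE C B).2.2.2 : ℚ) : ℝ) ∧ ((C.T1 : ℚ) : ℝ) ≤ T' ∧ T' ≤ ((C.T2 : ℚ) : ℝ) ∧ Ek T u θ ≤ Ek T' u θ) := by
  obtain ⟨hxa, hxb, hxa0, hcl, hch, hch1, hch2, _⟩ := point_data C hB hp
  set xa := toQ B.U1.x.lo with hxa'
  set xb := toQ B.U2.x.hi with hxb'
  set cl := toQ B.T2.cs.lo with hcl'
  set ch := toQ B.T1.cs.hi with hch'
  set Qlo : ℚ := (clampQ ch xa xb - ch) ^ 2 + (1 - ch ^ 2) with hQlo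
  set Qhi : ℚ := max (xa ^ 2 + 1 - 2 * xa * cl) (xb ^ 2 + 1 - 2 * xb * cl) with hQhi
  set Ta : ℚ := clampQ (Qlo / 8) C.T1 C.T2 with hTa
  set Tb : ℚ := clampQ (Qhi / 8) C.T1 C.T2 with hTb
  have hE : leafE C B = (rup (xb ^ 4 * expHi (-Qlo / (4 * Ta)) C.prec / (6 * Ta ^ 2)) C.prec,
      rdn (xa ^ 4 * min (expLo (-Qhi / (4 * Ta)) C.prec / Ta ^ 2) (expLo (-Qhi / (4 * Tb)) C.prec / Tb ^ 2) / 6) C.prec,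
      Ta, Tb) := rfl
  rw [hE]
  dsimp only
  have hQ1 : ((Qlo : ℚ) : ℝ) ≤ Qk u θ := by rw [hQlo]; exact Qlo_le_Qk hxa hxb hch
  have hQ2 : Qk u θ ≤ ((Qhi : ℚ) : ℝ) := by rw [hQhi]; exact Qk_le_Qhi hxa hxb hcl
  have hT1R : (0 : ℝ) < C.T1 := by exact_mod_cast hT1
  refine ⟨fun T h1 h2 => ?_, fun T h1 h2 => ?_, fun T h1 h2 => ?_⟩
  · have := Ek_upper C.prec hT1 h1 h2 hxa hxb hch hch1 hch2
    rw [← hQlo, ← hTa] at this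
    exact this
  · have hTa0 : 0 < Ta := lt_of_lt_of_le hT1 (le_max_left _ _)
    have := Ek_lower C.prec hxa0 hTa0 h1 h2 hxa hxb hcl
    rw [← hQhi] at this
    exact this
  · -- reduction of `T` to `[Ta, Tb]`
    have hTpos : 0 < T := hT1R.trans_le h1
    have hTa1 : ((C.T1 : ℚ) : ℝ) ≤ Ta := by exact_mod_cast (le_max_left _ _ : C.T1 ≤ Ta)
    have hTa2 : ((Ta : ℚ) : ℝ) ≤ C.T2 := by exact_mod_cast (max_le hT12 (min_le_right _ _) : Ta ≤ C.T2)
    have hTb1 : ((C.T1 : ℚ) : ℝ) ≤ Tb := by exact_mod_cast (le_max_left _ _ : C.T1 ≤ Tb)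
    have hTb2 : ((Tb : ℚ) : ℝ) ≤ C.T2 := by exact_mod_cast (max_le hT12 (min_le_right _ _) : Tb ≤ C.T2)
    have hab : Ta ≤ Tb := by
      have hQ : Qlo ≤ Qhi := by exact_mod_cast hQ1.trans hQ2
      rw [hTa, hTb]; unfold clampQ
      exact max_le_max le_rfl (min_le_min (by linarith) le_rfl)
    have habR : ((Ta : ℚ) : ℝ) ≤ Tb := by exact_mod_cast hab
    rcases lt_or_ge T ((Ta : ℚ) : ℝ) with hlt | hge
    · -- `T < Ta`: then `Ta = min (Qlo/8) T2 ≤ Qlo/8`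
      refine ⟨Ta, le_rfl, habR, hTa1, hTa2, ?_⟩
      have hTa_le : ((Ta : ℚ) : ℝ) ≤ (Qlo : ℝ) / 8 := by
        have h' : (C.T1 : ℚ) < min (Qlo / 8) C.T2 := by
          by_contra hc
          rw [not_lt] at hc
          have : Ta = C.T1 := by rw [hTa]; unfold clampQ; exact max_eq_left hc
          rw [this] at hlt; linarith
        have : Ta = min (Qlo / 8) C.T2 := by rw [hTa]; unfold clampQ; exact max_eq_right h'.le
        have : Ta ≤ Qlo / 8 := this ▸ min_le_left _ _
        have : ((Ta : ℚ) : ℝ) ≤ ((Qlo / 8 : ℚ) : ℝ) := by exact_mod_cast this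
        push_cast at this; exact this
      exact Ek_mono_T_of_le hTpos hlt.le (by linarith)
    rcases lt_or_ge ((Tb : ℚ) : ℝ) T with hgt | hle
    · -- `Tb < T`: then `Tb ≥ Qhi/8`
      refine ⟨Tb, habR, le_rfl, hTb1, hTb2, ?_⟩
      have hTb_ge : (Qhi : ℝ) / 8 ≤ ((Tb : ℚ) : ℝ) := by
        have h' : min (Qhi / 8) C.T2 = Qhi / 8 := by
          rcases le_total (Qhi / 8) C.T2 with hc | hc
          · exact min_eq_left hc
          · exfalso
            have : Tb = C.T2 := by
              rw [hTb]; unfold clampQ; rw [min_eq_right hc]; exact max_eq_right hT12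
            rw [this] at hgt; linarith
        have : Qhi / 8 ≤ Tb := by rw [hTb]; unfold clampQ; rw [h']; exact le_max_right _ _
        have : ((Qhi / 8 : ℚ) : ℝ) ≤ ((Tb : ℚ) : ℝ) := by exact_mod_cast this
        push_cast at this; exact this
      have hTb0 : (0 : ℝ) < Tb := hT1R.trans_le hTb1
      exact Ek_mono_T_of_ge hTb0 hgt.le (by linarith)
    · exact ⟨T, hge, hle, h1, h2, le_rfl⟩

/-! ### The derivative enclosures of the kernel -/

/-- **`∂_u E_T ∈ dEuBox`** and **`∂_θ E_T ∈ dEtBoxF`** for `T` in the envelope range (`0 < Ta`). [folklore] -/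
theorem dEBox_spec {tabs : List (List TabE)} {B : BoxD} (hB : BoxOK C tabs B) {u θ : ℝ} (hp : InBox B u θ)
    {E : ℚ × ℚ × ℚ × ℚ} (hTa : 0 < E.2.2.1) {T : ℝ} (h1 : ((E.2.2.1 : ℚ) : ℝ) ≤ T) (h2 : T ≤ ((E.2.2.2 : ℚ) : ℝ))
    (hElo : ((E.2.1 : ℚ) : ℝ) ≤ Ek T u θ) (hEhi : Ek T u θ ≤ ((E.1 : ℚ) : ℝ)) :
    MI.mem S64 (Ek T u θ * (4 - Real.exp u * (Real.exp u - Real.cos θ) / (2 * T))) (dEuBox B E) ∧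
      MI.mem S64 (-(Ek T u θ * Real.exp u * Real.sin θ / (2 * T))) (dEtBoxF C B E) := by
  obtain ⟨_, _, _, hcl, hch, _, _, hθ0, _⟩ := point_data C hB hp
  obtain ⟨⟨⟨hx1, _⟩, _, _⟩, ⟨⟨hx2, _⟩, _, _⟩, ⟨ht1, hcs1, _⟩, ⟨ht2, hcs2, _⟩, _⟩ := hB
  obtain ⟨hu1, hu2, hθ1, hθ2, hθπ⟩ := hp
  have hS := S64_cast_pos.2
  have hSp := S64_pos
  have hTa0 : (0 : ℝ) < E.2.2.1 := by exact_mod_cast hTa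
  have hT0 : 0 < T := hTa0.trans_le h1
  -- the factors
  have hEiv : MI.mem S64 (Ek T u θ) ⟨zlo64 E.2.1, zhi64 E.1⟩ := ⟨zlo64_le_of_le hElo, le_zhi64_of_le hEhi⟩
  have hX : MI.mem S64 (Real.exp u) ⟨B.U1.x.lo, B.U2.x.hi⟩ :=
    ⟨hx1.1.trans (mul_le_mul_of_nonneg_right (Real.exp_le_exp.2 hu1) hS.le),
      le_trans (mul_le_mul_of_nonneg_right (Real.exp_le_exp.2 hu2) hS.le) hx2.2⟩
  have hth1 : B.T1.th = (B.T1.t : ℝ) := min_eq_left (hθ1.trans hθπ)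
  have hT1 := TD.th_mem ht1
  have hT2 := TD.th_mem ht2
  have hCos : MI.mem S64 (Real.cos θ) ⟨B.T2.cs.lo, B.T1.cs.hi⟩ :=
    ⟨hcs2.1.trans (mul_le_mul_of_nonneg_right
        (Real.cos_le_cos_of_nonneg_of_le_pi hθ0 hT2.2 (le_min hθ2 hθπ)) hS.le),
      le_trans (mul_le_mul_of_nonneg_right (Real.cos_le_cos_of_nonneg_of_le_pi hT1.1 hθπ (hth1 ▸ hθ1)) hS.le) hcs1.2⟩
  have hInv : MI.mem S64 (1 / (2 * T)) ⟨zlo64 (1 / (2 * E.2.2.2)), zhi64 (1 / (2 * E.2.2.1))⟩ := by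
    refine ⟨zlo64_le_of_le ?_, le_zhi64_of_le ?_⟩
    · push_cast
      exact div_le_div_of_nonneg_left zero_le_one (by positivity) (by linarith)
    · push_cast
      exact div_le_div_of_nonneg_left zero_le_one (by positivity) (by linarith)
  have h4 : MI.mem S64 (4 : ℝ) (MI.ofInt S64 4) := by
    have := MI.mem_ofInt S64 4; simpa using this
  constructor
  · have h := MI.mem_mul hSp hEiv (MI.mem_sub h4 (MI.mem_mul hSp (MI.mem_mul hSp hX (MI.mem_sub hX hCos)) hInv))
    have e : Ek T u θ * (4 - Real.exp u * (Real.exp u - Real.cos θ) * (1 / (2 * T))) =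
        Ek T u θ * (4 - Real.exp u * (Real.exp u - Real.cos θ) / (2 * T)) := by ring
    rw [e] at h
    exact h
  · obtain ⟨hs1, hs2⟩ := sin_memF C.prec hθ0 hθπ hcl hch
    have hSn : MI.mem S64 (Real.sin θ)
        ⟨zlo64 (ksqrtLoF (1 - max (toQ B.T2.cs.lo ^ 2) (toQ B.T1.cs.hi ^ 2)) C.prec),
          zhi64 (ksqrtHiF (1 - (if 0 ≤ toQ B.T2.cs.lo then toQ B.T2.cs.lo ^ 2
            else if toQ B.T1.cs.hi ≤ 0 then toQ B.T1.cs.hi ^ 2 else 0)) C.prec)⟩ :=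
      ⟨zlo64_le_of_le hs1, le_zhi64_of_le hs2⟩
    have h := MI.mem_neg (MI.mem_mul hSp (MI.mem_mul hSp (MI.mem_mul hSp hEiv hX) hSn) hInv)
    have e : -(Ek T u θ * Real.exp u * Real.sin θ * (1 / (2 * T))) = -(Ek T u θ * Real.exp u * Real.sin θ / (2 * T)) := by
      ring
    rw [e] at h
    exact h

/-! ### The corner margin -/

/-- `dminBox ≤ S · (R - E_T)` at each of the four corners, for every `T ∈ [T₁, T₂]`. [folklore] -/
theorem dminBox_spec (hat : atomsOK C C.atoms = true) {tabs : List (List TabE)} {B : BoxD} (hB : BoxOK C tabs B)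
    {T : ℝ} (h1 : ((C.T1 : ℚ) : ℝ) ≤ T) (h2 : T ≤ ((C.T2 : ℚ) : ℝ)) :
    ((dminBox C B : ℤ) : ℝ) ≤ (C.R B.U1.u B.T1.th - Ek T B.U1.u B.T1.th) * S64 ∧
    ((dminBox C B : ℤ) : ℝ) ≤ (C.R B.U1.u B.T2.th - Ek T B.U1.u B.T2.th) * S64 ∧
    ((dminBox C B : ℤ) : ℝ) ≤ (C.R B.U2.u B.T1.th - Ek T B.U2.u B.T1.th) * S64 ∧
    ((dminBox C B : ℤ) : ℝ) ≤ (C.R B.U2.u B.T2.th - Ek T B.U2.u B.T2.th) * S64 := by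
  obtain ⟨hU1, hU2, hT1, hT2, he11, he12, he21, he22, _⟩ := hB
  unfold dminBox
  push_cast
  refine ⟨?_, ?_, ?_, ?_⟩
  · refine (min_le_left _ _).trans ((min_le_left _ _).trans ?_)
    have := rCorner_spec C hat hU1 hT1; have := he11 T h1 h2; rw [sub_mul]; linarith
  · refine (min_le_left _ _).trans ((min_le_right _ _).trans ?_)
    have := rCorner_spec C hat hU1 hT2; have := he12 T h1 h2; rw [sub_mul]; linarith
  · refine (min_le_right _ _).trans ((min_le_left _ _).trans ?_)
    have := rCorner_spec C hat hU2 hT1; have := he21 T h1 h2; rw [sub_mul]; linarith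
  · refine (min_le_right _ _).trans ((min_le_right _ _).trans ?_)
    have := rCorner_spec C hat hU2 hT2; have := he22 T h1 h2; rw [sub_mul]; linarith

/-! ### One-dimensional mean value bounds -/

/-- MVT along `u`: a derivative bound `|φ'| ≤ K` on `[u₁, u₂]` gives `φ(c) - K |u - c| ≤ φ(u)` for `u, c ∈ [u₁, u₂]`.
[folklore] -/
theorem mvt_lower {φ φ' : ℝ → ℝ} {a b K : ℝ} (hd : ∀ x ∈ Icc a b, HasDerivAt φ (φ' x) x)
    (hK : ∀ x ∈ Icc a b, |φ' x| ≤ K) {x c : ℝ} (hx : x ∈ Icc a b) (hc : c ∈ Icc a b) :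
    φ c - K * |x - c| ≤ φ x := by
  have h := Convex.norm_image_sub_le_of_norm_hasDerivWithin_le (fun y hy => (hd y hy).hasDerivWithinAt)
    (fun y hy => by rw [Real.norm_eq_abs]; exact hK y hy) (convex_Icc a b) hc hx
  rw [Real.norm_eq_abs, Real.norm_eq_abs] at h
  have := (abs_sub_abs_le_abs_sub _ _).trans h
  have h' : -(K * |x - c|) ≤ φ x - φ c := by
    have := neg_abs_le (φ x - φ c); linarith
  linarith

end KCert

/-- Registered sub-goal marker `stub_certMid_part10` of crux stmt-SmoothPoincare4-7631 (helper file 10 of the kernel-clean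
`stub_certMid`, line killing-flux): the one-dimensional mean value bound used by the corner test. [folklore] -/
theorem stub_certMid_part10 : ∀ (φ φ' : ℝ → ℝ) (a b K x c : ℝ), (∀ y ∈ Set.Icc a b, HasDerivAt φ (φ' y) y) → (∀ y ∈ Set.Icc a b, |φ' y| ≤ K) → x ∈ Set.Icc a b → c ∈ Set.Icc a b → φ c - K * |x - c| ≤ φ x :=
  fun _ _ _ _ _ _ _ hd hK hx hc => KCert.mvt_lower hd hK hx hc

end Summit.SmoothPoincare4.SmoothPoincare4.Cruxes.CylinderRungTwo.KillingFlux

end
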